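import Mathlib.MeasureTheory.Function.ConditionalExpectation.Real
import Mathlib.MeasureTheory.Function.ConditionalExpectation.PullOut
import Mathlib.MeasureTheory.Measure.WithDensity
import Mathlib.MeasureTheory.Integral.Bochner.Set
import Mathlib.MeasureTheory.Integral.Bochner.ContinuousLinearMap
import Mathlib.MeasureTheory.Integral.IntegrableOn
import Summits.AtomisticToContinuum.HydrodynamicLimit.Theorems.InformationPercolationEngineKickFairRelEquilibriumCondExpDensity
import HarnessLib

/-!
# `InformationPercolationEngine.KickFairRelEquilibriumMeso` (stmt-AtomisticToContinuum-15177):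
# transversal reweighting — conditional means given the past survive a leaf-measurable change of
# density when the observable is leafwise fair (exact and quantitative forms)

Helper file (`--supports stmt-AtomisticToContinuum-15177`) carrying the abstract lever of the crux
idea card `unstable-leaf-reweighting` (crux-ideate round 2, ideator 5; `Cruxes/KickFairRelEquilibriumMeso/
Ideas/unstable-leaf-reweighting.md`, sketch `LeafReweightingSketch.lean`). Pure measure theory.

Three σ-algebras on one space: the PAST `mP`, the LEAF algebra `mL` with `mP ≤ mL ≤ m0`, and the
ambient `m0`; a finite reference law `ν` (the invariant Gibbs law in the card) and a reweighted law
`ν.withDensity ρ` (the evolved local Gibbs law).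

* `condExp_withDensity_ae_eq_of_leafFair` (exact form): if `ρ` is `mL`-measurable and `g` is
  leafwise fair under `ν` (`ν[g | mL] = ν[g | mP]` a.e.), then `(ν.withDensity ρ)[g | mP] = ν[g | mP]`
  almost everywhere for the reweighted law — whatever the (transversal) weight `ρ`.
* `integral_abs_condExp_withDensity_sub_le_of_near_measurable` (density within a factor `1 + θ`
  of another measurable density `ρL ≤ ρ`, `|g| ≤ C`, NO fairness and no leaf structure):
  `∫ |(ν.withDensity ρ)[g|mP] − (ν.withDensity ρL)[g|mP]| d(ν.withDensity ρ) ≤ 2 C θ · mass`.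
* `integral_abs_condExp_withDensity_sub_le` (quantitative transversal reweighting, the shape the
  card's Transfer consumes kick by kick): leafwise fairness up to `η` (`ν`-a.e.) and a density within
  a factor `1 + θ` of a leaf-measurable one give
  `∫ |(ν.withDensity ρ)[g|mP] − ν[g|mP]| d(ν.withDensity ρ) ≤ (η + 2 C θ) · mass`.

Proofs. The exact form is the tower property over the landed density-invariance lemma
`condExp_withDensity_ae_eq_of_measurable` (p99854). The quantitative form splits through the
intermediate law `νL = ν.withDensity ρL`: (1) under `νL` the density is leaf-measurable, so
`νL[g|mP] − ν[g|mP] = νL[ν[g|mL] − ν[g|mP] | mP]` is bounded by `η` a.e.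
(`ae_bdd_abs_condExp_of_ae_bdd_abs`); (2) testing `Y − Z` (`Y = (ν.withDensity ρ)[g|mP]`, `Z = νL[g|mP]`)
against its own `mP`-measurable sign `s` and pulling everything back to `ν`,
`∫ |Y − Z| d(ν.withDensity ρ) = ∫ (ρ − ρL)·s·(g − Z) dν ≤ 2 C θ · mass`.
No Bayes quotient is formed, so no division by a conditional density occurs.
-/

noncomputable section

open MeasureTheory Set Filter Topology
open scoped ENNReal NNReal

namespace Summit.AtomisticToContinuum.HydrodynamicLimit.Theorems

/-- **Transversal reweighting (exact form).** `mP ≤ mL ≤ m0`; `ρ` an `mL`-measurable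
(leaf-measurable) density; if `g` is leafwise fair under `ν` — conditioning down from the leaf
algebra `mL` to the past `mP` does not change its conditional mean — then its conditional mean given
the past is the same under `ν.withDensity ρ` as under `ν`, almost everywhere for the reweighted law,
whatever the reweighting `ρ`. [folklore; tower property + `condExp_withDensity_ae_eq_of_measurable`] -/
theorem condExp_withDensity_ae_eq_of_leafFair
    {Ω : Type*} {mP mL m0 : MeasurableSpace Ω} (hPL : mP ≤ mL) (hL0 : mL ≤ m0)
    (ν : Measure Ω) [IsFiniteMeasure ν] (ρ : Ω → ℝ≥0) (hρ : Measurable[mL] ρ)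
    [IsFiniteMeasure (ν.withDensity fun x => (ρ x : ℝ≥0∞))]
    (g : Ω → ℝ) (hg : Integrable g ν) (hρg : Integrable (fun x => (ρ x : ℝ) * g x) ν)
    (hρc : Integrable (fun x => (ρ x : ℝ) * (MeasureTheory.condExp mP ν g) x) ν)
    (hleaf : MeasureTheory.condExp mL ν g =ᵐ[ν] MeasureTheory.condExp mP ν g) :
    MeasureTheory.condExp mP (ν.withDensity fun x => (ρ x : ℝ≥0∞)) g
      =ᵐ[ν.withDensity fun x => (ρ x : ℝ≥0∞)] MeasureTheory.condExp mP ν g := by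
  set νρ : Measure Ω := ν.withDensity fun x => (ρ x : ℝ≥0∞) with hνρ
  have hP0 : mP ≤ m0 := hPL.trans hL0
  -- leaf-measurable density does not change conditional means given the leaf algebra
  have hB : MeasureTheory.condExp mL νρ g =ᵐ[νρ] MeasureTheory.condExp mL ν g :=
    condExp_withDensity_ae_eq_of_measurable hL0 ν ρ hρ g hg hρg
  -- leafwise fairness, transported to `νρ`-a.e. by absolute continuity
  have hac : νρ ≪ ν := withDensity_absolutelyContinuous ν _
  have hC : MeasureTheory.condExp mL ν g =ᵐ[νρ] MeasureTheory.condExp mP ν g := hac.ae_eq hleaf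
  -- tower property under `νρ`
  have hA : MeasureTheory.condExp mP νρ (MeasureTheory.condExp mL νρ g)
      =ᵐ[νρ] MeasureTheory.condExp mP νρ g :=
    condExp_condExp_of_le hPL hL0
  have hD : MeasureTheory.condExp mP νρ (MeasureTheory.condExp mL νρ g)
      =ᵐ[νρ] MeasureTheory.condExp mP νρ (MeasureTheory.condExp mP ν g) :=
    condExp_congr_ae (hB.trans hC)
  -- an `mP`-measurable, `νρ`-integrable function is its own conditional expectation
  have hint : Integrable (MeasureTheory.condExp mP ν g) νρ := by
    rw [hνρ, integrable_withDensity_iff_integrable_smul (hρ.mono hL0 le_rfl)]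
    refine hρc.congr (Eventually.of_forall fun x => ?_)
    simp only [NNReal.smul_def, smul_eq_mul]
  have hE : MeasureTheory.condExp mP νρ (MeasureTheory.condExp mP ν g)
      = MeasureTheory.condExp mP ν g :=
    condExp_of_stronglyMeasurable hP0 stronglyMeasurable_condExp hint
  rw [← hE]
  exact hA.symm.trans hD

/-- **Reweighting by a nearly dominated density moves past-conditional means by at most `2 C θ` in
`L¹`.** `mP ≤ m0`; densities `ρL ≤ ρ ≤ (1 + θ) ρL` pointwise, both measurable (no leaf structure is
used in this half); `|g| ≤ C` measurable. Then, with `Y = (ν.withDensity ρ)[g | mP]` and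
`Z = (ν.withDensity ρL)[g | mP]`, `∫ |Y − Z| d(ν.withDensity ρ) ≤ 2 C θ · (ν.withDensity ρ)(univ)`.
Proof: test `Y − Z` against its own (`mP`-measurable) sign and pull both conditional expectations
back to `ν`: `∫ |Y − Z| d(ν.withDensity ρ) = ∫ (ρ − ρL) · sign · (g − Z) dν`. [folklore] -/
theorem integral_abs_condExp_withDensity_sub_le_of_near_measurable
    {Ω : Type*} {mP m0 : MeasurableSpace Ω} (hP0 : mP ≤ m0)
    (ν : Measure Ω) [IsFiniteMeasure ν] (ρ ρL : Ω → ℝ≥0) (hρ0 : Measurable ρ) (hρL0 : Measurable ρL)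
    [IsFiniteMeasure (ν.withDensity fun x => (ρ x : ℝ≥0∞))]
    (θ C : ℝ) (hθ : 0 ≤ θ)
    (hρL : ∀ x, ρL x ≤ ρ x ∧ (ρ x : ℝ) ≤ (1 + θ) * ρL x)
    (g : Ω → ℝ) (hgm : Measurable g) (hgb : ∀ x, |g x| ≤ C) :
    ∫ x, |MeasureTheory.condExp mP (ν.withDensity fun x => (ρ x : ℝ≥0∞)) g x
        - MeasureTheory.condExp mP (ν.withDensity fun x => (ρL x : ℝ≥0∞)) g x|
        ∂(ν.withDensity fun x => (ρ x : ℝ≥0∞))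
      ≤ 2 * C * θ * ((ν.withDensity fun x => (ρ x : ℝ≥0∞)) Set.univ).toReal := by
  classical
  set νρ : Measure Ω := ν.withDensity fun x => (ρ x : ℝ≥0∞) with hνρ
  set νL : Measure Ω := ν.withDensity fun x => (ρL x : ℝ≥0∞) with hνL
  have hle : νL ≤ νρ :=
    withDensity_mono (Eventually.of_forall fun x => ENNReal.coe_le_coe.2 (hρL x).1)
  haveI : IsFiniteMeasure νL := isFiniteMeasure_of_le νρ hle
  -- bounded measurable `g` is integrable for every finite measure
  have hgi : ∀ (μ : Measure Ω) [IsFiniteMeasure μ], Integrable g μ := fun μ _ =>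
    Integrable.of_bound hgm.aestronglyMeasurable C
      (Eventually.of_forall fun x => by rw [Real.norm_eq_abs]; exact hgb x)
  -- `νL`-a.e. statements transfer to `νρ`-a.e. (`ρL = 0 ⇒ ρ = 0`)
  have hLρ : ∀ {p : Ω → Prop}, (∀ᵐ x ∂νL, p x) → ∀ᵐ x ∂νρ, p x := by
    intro p hp
    rw [hνL, ae_withDensity_iff hρL0.coe_nnreal_ennreal] at hp
    rw [hνρ, ae_withDensity_iff hρ0.coe_nnreal_ennreal]
    filter_upwards [hp] with x hx hρx
    refine hx fun h0 => hρx ?_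
    have h0' : ρL x = 0 := by exact_mod_cast h0
    have h2 : (ρ x : ℝ) ≤ (1 + θ) * ρL x := (hρL x).2
    rw [h0', NNReal.coe_zero, mul_zero] at h2
    have h3 : (ρ x : ℝ) = 0 := le_antisymm h2 (NNReal.coe_nonneg _)
    have h4 : ρ x = 0 := by exact_mod_cast h3
    rw [h4, ENNReal.coe_zero]
  -- integrals against the reweighted laws, pulled back to `ν`
  have hconv : ∀ f : Ω → ℝ, ∫ x, f x ∂νρ = ∫ x, (ρ x : ℝ) * f x ∂ν := fun f => by
    rw [hνρ, integral_withDensity_eq_integral_smul hρ0]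
    simp only [NNReal.smul_def, smul_eq_mul]
  have hconvL : ∀ f : Ω → ℝ, ∫ x, f x ∂νL = ∫ x, (ρL x : ℝ) * f x ∂ν := fun f => by
    rw [hνL, integral_withDensity_eq_integral_smul hρL0]
    simp only [NNReal.smul_def, smul_eq_mul]
  have hintρ : ∀ f : Ω → ℝ, Integrable f νρ → Integrable (fun x => (ρ x : ℝ) * f x) ν := by
    intro f hf
    rw [hνρ, integrable_withDensity_iff_integrable_smul hρ0] at hf
    simpa only [NNReal.smul_def, smul_eq_mul] using hf
  have hintL : ∀ f : Ω → ℝ, Integrable f νL → Integrable (fun x => (ρL x : ℝ) * f x) ν := by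
    intro f hf
    rw [hνL, integrable_withDensity_iff_integrable_smul hρL0] at hf
    simpa only [NNReal.smul_def, smul_eq_mul] using hf
  -- the two conditional expectations and the sign of their difference
  set Y : Ω → ℝ := MeasureTheory.condExp mP νρ g with hY
  set Z : Ω → ℝ := MeasureTheory.condExp mP νL g with hZ
  have hYm : StronglyMeasurable[mP] Y := stronglyMeasurable_condExp
  have hZm : StronglyMeasurable[mP] Z := stronglyMeasurable_condExp
  have hZbd : ∀ᵐ x ∂νL, |Z x| ≤ C :=
    ae_bdd_abs_condExp_of_ae_bdd_abs (m := mP) (μ := νL) (Eventually.of_forall hgb)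
  have hZiρ : Integrable Z νρ :=
    Integrable.of_bound (hZm.mono hP0).aestronglyMeasurable C
      (by filter_upwards [hLρ hZbd] with x hx; rw [Real.norm_eq_abs]; exact hx)
  set s : Ω → ℝ := fun x => if Z x ≤ Y x then 1 else -1 with hs
  have hsm : StronglyMeasurable[mP] s :=
    StronglyMeasurable.ite (hZm.measurableSet_le hYm) stronglyMeasurable_const
      stronglyMeasurable_const
  have hs_bd : ∀ x, ‖s x‖ ≤ 1 := by
    intro x; simp only [hs]; split_ifs <;> simp
  have hs_abs : ∀ x, s x * (Y x - Z x) = |Y x - Z x| := by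
    intro x; simp only [hs]; split_ifs with h
    · rw [one_mul, abs_of_nonneg (sub_nonneg.2 h)]
    · rw [neg_one_mul, abs_of_neg (sub_neg.2 (not_le.1 h))]
  -- integrability bookkeeping
  have hsgρ : Integrable (fun x => s x * g x) νρ :=
    (hgi νρ).bdd_mul (hsm.mono hP0).aestronglyMeasurable (Eventually.of_forall hs_bd)
  have hsgL : Integrable (fun x => s x * g x) νL :=
    (hgi νL).bdd_mul (hsm.mono hP0).aestronglyMeasurable (Eventually.of_forall hs_bd)
  have hsYρ : Integrable (fun x => s x * Y x) νρ :=
    integrable_condExp.bdd_mul (hsm.mono hP0).aestronglyMeasurable (Eventually.of_forall hs_bd)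
  have hsZρ : Integrable (fun x => s x * Z x) νρ :=
    hZiρ.bdd_mul (hsm.mono hP0).aestronglyMeasurable (Eventually.of_forall hs_bd)
  have hsZL : Integrable (fun x => s x * Z x) νL :=
    integrable_condExp.bdd_mul (hsm.mono hP0).aestronglyMeasurable (Eventually.of_forall hs_bd)
  -- (i) testing `Y` against `s` under `νρ` and `Z` against `s` under `νL`
  have hpullρ : MeasureTheory.condExp mP νρ (fun x => s x * g x) =ᵐ[νρ] fun x => s x * Y x :=
    condExp_mul_of_stronglyMeasurable_left hsm hsgρ (hgi νρ)
  have hpullL : MeasureTheory.condExp mP νL (fun x => s x * g x) =ᵐ[νL] fun x => s x * Z x :=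
    condExp_mul_of_stronglyMeasurable_left hsm hsgL (hgi νL)
  have hI1 : ∫ x, s x * Y x ∂νρ = ∫ x, s x * g x ∂νρ :=
    calc ∫ x, s x * Y x ∂νρ
        = ∫ x, MeasureTheory.condExp mP νρ (fun x => s x * g x) x ∂νρ :=
          (integral_congr_ae hpullρ).symm
      _ = ∫ x, s x * g x ∂νρ := integral_condExp hP0
  have hI2 : ∫ x, s x * Z x ∂νL = ∫ x, s x * g x ∂νL :=
    calc ∫ x, s x * Z x ∂νL
        = ∫ x, MeasureTheory.condExp mP νL (fun x => s x * g x) x ∂νL :=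
          (integral_congr_ae hpullL).symm
      _ = ∫ x, s x * g x ∂νL := integral_condExp hP0
  -- (ii) the identity `∫ |Y − Z| dνρ = ∫ (ρ − ρL)·s·(g − Z) dν`
  have hA : Integrable (fun x => (ρ x : ℝ) * (s x * g x)) ν := hintρ _ hsgρ
  have hB : Integrable (fun x => (ρ x : ℝ) * (s x * Z x)) ν := hintρ _ hsZρ
  have hCi : Integrable (fun x => (ρL x : ℝ) * (s x * g x)) ν := hintL _ hsgL
  have hD : Integrable (fun x => (ρL x : ℝ) * (s x * Z x)) ν := hintL _ hsZL
  have hmain : ∫ x, |Y x - Z x| ∂νρ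
      = ∫ x, ((ρ x : ℝ) - ρL x) * (s x * (g x - Z x)) ∂ν := by
    have e1 : ∫ x, |Y x - Z x| ∂νρ = ∫ x, (s x * Y x - s x * Z x) ∂νρ := by
      refine integral_congr_ae (Eventually.of_forall fun x => ?_)
      simp only [← hs_abs, mul_sub]
    have e2 : ∫ x, (ρL x : ℝ) * (s x * g x) ∂ν = ∫ x, (ρL x : ℝ) * (s x * Z x) ∂ν := by
      rw [← hconvL, ← hconvL, hI2]
    have e3 : (fun x => ((ρ x : ℝ) - ρL x) * (s x * (g x - Z x)))
        = fun x => ((ρ x : ℝ) * (s x * g x) - (ρ x : ℝ) * (s x * Z x))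
            - ((ρL x : ℝ) * (s x * g x) - (ρL x : ℝ) * (s x * Z x)) := by
      funext x; ring
    have hAB : Integrable (fun x => (ρ x : ℝ) * (s x * g x) - (ρ x : ℝ) * (s x * Z x)) ν :=
      hA.sub hB
    have hCD : Integrable (fun x => (ρL x : ℝ) * (s x * g x) - (ρL x : ℝ) * (s x * Z x)) ν :=
      hCi.sub hD
    rw [e1, integral_sub hsYρ hsZρ, hI1, hconv, hconv, e3, integral_sub hAB hCD,
      integral_sub hA hB, integral_sub hCi hD, e2, sub_self, sub_zero]
  -- (iii) the pointwise bound `|(ρ − ρL)·s·(g − Z)| ≤ 2Cθ·ρ`, `ν`-a.e.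
  have hkey : ∀ᵐ x ∂ν, ‖((ρ x : ℝ) - ρL x) * (s x * (g x - Z x))‖ ≤ 2 * C * θ * (ρ x : ℝ) := by
    have hZν : ∀ᵐ x ∂ν, (ρL x : ℝ≥0∞) ≠ 0 → |Z x| ≤ C := by
      have h := hZbd
      rw [hνL, ae_withDensity_iff hρL0.coe_nnreal_ennreal] at h
      exact h
    filter_upwards [hZν] with x hx
    obtain ⟨h1, h2⟩ := hρL x
    have h1' : (ρL x : ℝ) ≤ ρ x := by exact_mod_cast h1
    by_cases hb : ρL x = 0
    · rw [hb, NNReal.coe_zero, mul_zero] at h2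
      have h3 : (ρ x : ℝ) = 0 := le_antisymm h2 (NNReal.coe_nonneg _)
      rw [h3, hb, NNReal.coe_zero, sub_zero, zero_mul, norm_zero, mul_zero]
    · have hZx : |Z x| ≤ C := hx (by exact_mod_cast hb)
      have hgZ : |g x - Z x| ≤ 2 * C :=
        calc |g x - Z x| ≤ |g x| + |Z x| := abs_sub _ _
          _ ≤ C + C := add_le_add (hgb x) hZx
          _ = 2 * C := by ring
      have hsx : |s x| ≤ 1 := by simpa only [Real.norm_eq_abs] using hs_bd x
      have hρx : 0 ≤ (ρ x : ℝ) := NNReal.coe_nonneg _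
      have hab : (ρ x : ℝ) - ρL x ≤ θ * ρ x := by nlinarith
      rw [Real.norm_eq_abs, abs_mul, abs_mul, abs_of_nonneg (sub_nonneg.2 h1')]
      calc ((ρ x : ℝ) - ρL x) * (|s x| * |g x - Z x|)
          ≤ (θ * ρ x) * (1 * (2 * C)) :=
            mul_le_mul hab (mul_le_mul hsx hgZ (abs_nonneg _) zero_le_one)
              (mul_nonneg (abs_nonneg _) (abs_nonneg _)) (mul_nonneg hθ hρx)
        _ = 2 * C * θ * ρ x := by ring
  -- (iv) the mass identity `∫ ρ dν = νρ(univ)`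
  have hρi : Integrable (fun x => (ρ x : ℝ)) ν := by
    simpa only [mul_one] using hintρ (fun _ => (1 : ℝ)) (integrable_const 1)
  have hmass : ∫ x, (ρ x : ℝ) ∂ν = (νρ Set.univ).toReal := by
    have h := hconv fun _ => (1 : ℝ)
    simp only [mul_one, integral_const, smul_eq_mul, measureReal_def] at h
    exact h.symm
  -- conclusion
  calc ∫ x, |Y x - Z x| ∂νρ
      = ∫ x, ((ρ x : ℝ) - ρL x) * (s x * (g x - Z x)) ∂ν := hmain
    _ ≤ ‖∫ x, ((ρ x : ℝ) - ρL x) * (s x * (g x - Z x)) ∂ν‖ := Real.le_norm_self _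
    _ ≤ ∫ x, 2 * C * θ * (ρ x : ℝ) ∂ν := norm_integral_le_of_norm_le (hρi.const_mul _) hkey
    _ = 2 * C * θ * (νρ Set.univ).toReal := by rw [integral_const_mul, hmass]

/-- **Transversal reweighting, quantitative form** (the shape the leaf-reweighting line consumes
kick by kick). `mP ≤ mL ≤ m0`; leafwise fairness of `g` up to `η` for `ν`-almost every point
(`|ν[g|mL] − ν[g|mP]| ≤ η`); a measurable density `ρ` within a factor `1 + θ` of a leaf-measurable
density `ρL ≤ ρ`; `|g| ≤ C` measurable. Then the past-conditional means of `g` under the reweighted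
law `ν.withDensity ρ` and under `ν` differ by at most `(η + 2 C θ) · (ν.withDensity ρ)(univ)` in
`L¹(ν.withDensity ρ)`. [folklore] -/
theorem integral_abs_condExp_withDensity_sub_le :
    ∀ {Ω : Type*} {mP mL m0 : MeasurableSpace Ω}, mP ≤ mL → mL ≤ m0 →
      ∀ (ν : Measure Ω) [IsFiniteMeasure ν] (ρ : Ω → ℝ≥0), Measurable ρ →
      ∀ [IsFiniteMeasure (ν.withDensity fun x => (ρ x : ℝ≥0∞))] (θ η C : ℝ), 0 ≤ θ →
      (∃ ρL : Ω → ℝ≥0, Measurable[mL] ρL ∧ ∀ x, ρL x ≤ ρ x ∧ (ρ x : ℝ) ≤ (1 + θ) * ρL x) →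
      ∀ g : Ω → ℝ, Measurable g → (∀ x, |g x| ≤ C) →
      (∀ᵐ x ∂ν, |MeasureTheory.condExp mL ν g x - MeasureTheory.condExp mP ν g x| ≤ η) →
      ∫ x, |MeasureTheory.condExp mP (ν.withDensity fun x => (ρ x : ℝ≥0∞)) g x
          - MeasureTheory.condExp mP ν g x| ∂(ν.withDensity fun x => (ρ x : ℝ≥0∞))
        ≤ (η + 2 * C * θ) * ((ν.withDensity fun x => (ρ x : ℝ≥0∞)) Set.univ).toReal := by
  intro Ω mP mL m0 hPL hL0 ν _ ρ hρ0 _ θ η C hθ hρL g hgm hgb hleaf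
  classical
  obtain ⟨ρL, hρLm, hρL⟩ := hρL
  have hP0 : mP ≤ m0 := hPL.trans hL0
  have hρL0 : Measurable ρL := hρLm.mono hL0 le_rfl
  -- the near-measurability half (no leaf structure)
  have h2 := integral_abs_condExp_withDensity_sub_le_of_near_measurable hP0 ν ρ ρL hρ0 hρL0 θ C hθ
    hρL g hgm hgb
  set νρ : Measure Ω := ν.withDensity fun x => (ρ x : ℝ≥0∞) with hνρ
  set νL : Measure Ω := ν.withDensity fun x => (ρL x : ℝ≥0∞) with hνL
  have hle : νL ≤ νρ :=
    withDensity_mono (Eventually.of_forall fun x => ENNReal.coe_le_coe.2 (hρL x).1)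
  haveI : IsFiniteMeasure νL := isFiniteMeasure_of_le νρ hle
  have hacL : νL ≪ ν := withDensity_absolutelyContinuous ν _
  have hacρ : νρ ≪ ν := withDensity_absolutelyContinuous ν _
  have hgi : ∀ (μ : Measure Ω) [IsFiniteMeasure μ], Integrable g μ := fun μ _ =>
    Integrable.of_bound hgm.aestronglyMeasurable C
      (Eventually.of_forall fun x => by rw [Real.norm_eq_abs]; exact hgb x)
  have hLρ : ∀ {p : Ω → Prop}, (∀ᵐ x ∂νL, p x) → ∀ᵐ x ∂νρ, p x := by
    intro p hp
    rw [hνL, ae_withDensity_iff hρL0.coe_nnreal_ennreal] at hp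
    rw [hνρ, ae_withDensity_iff hρ0.coe_nnreal_ennreal]
    filter_upwards [hp] with x hx hρx
    refine hx fun h0 => hρx ?_
    have h0' : ρL x = 0 := by exact_mod_cast h0
    have h2 : (ρ x : ℝ) ≤ (1 + θ) * ρL x := (hρL x).2
    rw [h0', NNReal.coe_zero, mul_zero] at h2
    have h3 : (ρ x : ℝ) = 0 := le_antisymm h2 (NNReal.coe_nonneg _)
    have h4 : ρ x = 0 := by exact_mod_cast h3
    rw [h4, ENNReal.coe_zero]
  -- names
  set X : Ω → ℝ := MeasureTheory.condExp mP ν g with hX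
  set XL : Ω → ℝ := MeasureTheory.condExp mL ν g with hXL
  set Y : Ω → ℝ := MeasureTheory.condExp mP νρ g with hY
  set Z : Ω → ℝ := MeasureTheory.condExp mP νL g with hZ
  -- a.e. bounds by `C`
  have hbdd : ∀ (μ : Measure Ω) (m : MeasurableSpace Ω),
      ∀ᵐ x ∂μ, |MeasureTheory.condExp m μ g x| ≤ C := fun μ m =>
    ae_bdd_abs_condExp_of_ae_bdd_abs (m := m) (μ := μ) (Eventually.of_forall hgb)
  -- integrability of the three past-conditional means under the laws where they are used
  have hXiL : Integrable X νL :=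
    Integrable.of_bound ((stronglyMeasurable_condExp (m := mP)).mono hP0).aestronglyMeasurable C
      (by filter_upwards [hacL.ae_le (hbdd ν mP)] with x hx; rw [Real.norm_eq_abs]; exact hx)
  have hXLiL : Integrable XL νL :=
    Integrable.of_bound ((stronglyMeasurable_condExp (m := mL)).mono hL0).aestronglyMeasurable C
      (by filter_upwards [hacL.ae_le (hbdd ν mL)] with x hx; rw [Real.norm_eq_abs]; exact hx)
  have hXiρ : Integrable X νρ :=
    Integrable.of_bound ((stronglyMeasurable_condExp (m := mP)).mono hP0).aestronglyMeasurable C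
      (by filter_upwards [hacρ.ae_le (hbdd ν mP)] with x hx; rw [Real.norm_eq_abs]; exact hx)
  have hZiρ : Integrable Z νρ :=
    Integrable.of_bound ((stronglyMeasurable_condExp (m := mP)).mono hP0).aestronglyMeasurable C
      (by filter_upwards [hLρ (hbdd νL mP)] with x hx; rw [Real.norm_eq_abs]; exact hx)
  have hYiρ : Integrable Y νρ := integrable_condExp
  -- (1) the leaf half: `|Z − X| ≤ η` almost everywhere
  have hρLg : Integrable (fun x => (ρL x : ℝ) * g x) ν := by
    have h := hgi νL
    rw [hνL, integrable_withDensity_iff_integrable_smul hρL0] at h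
    simpa only [NNReal.smul_def, smul_eq_mul] using h
  have h99 : MeasureTheory.condExp mL νL g =ᵐ[νL] XL :=
    condExp_withDensity_ae_eq_of_measurable hL0 ν ρL hρLm g (hgi ν) hρLg
  have hZ1 : MeasureTheory.condExp mP νL (MeasureTheory.condExp mL νL g) =ᵐ[νL] Z :=
    condExp_condExp_of_le hPL hL0
  have hZ2 : MeasureTheory.condExp mP νL (MeasureTheory.condExp mL νL g)
      =ᵐ[νL] MeasureTheory.condExp mP νL XL :=
    condExp_congr_ae h99
  have hX1 : MeasureTheory.condExp mP νL X = X :=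
    condExp_of_stronglyMeasurable hP0 stronglyMeasurable_condExp hXiL
  have hZ3 : MeasureTheory.condExp mP νL (XL - X)
      =ᵐ[νL] MeasureTheory.condExp mP νL XL - MeasureTheory.condExp mP νL X :=
    condExp_sub hXLiL hXiL mP
  have hbd : ∀ᵐ x ∂νL, |MeasureTheory.condExp mP νL (XL - X) x| ≤ η := by
    have hleafL : ∀ᵐ x ∂νL, |(XL - X) x| ≤ η := by
      filter_upwards [hacL.ae_le hleaf] with x hx
      rw [Pi.sub_apply]
      exact hx
    exact ae_bdd_abs_condExp_of_ae_bdd_abs (m := mP) (μ := νL) hleafL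
  have hZX : ∀ᵐ x ∂νL, |Z x - X x| ≤ η := by
    filter_upwards [hZ1, hZ2, hZ3, hbd] with x h1 h2 h3 h4
    have hx : Z x - X x = MeasureTheory.condExp mP νL (XL - X) x := by
      rw [← h1, h2, h3, Pi.sub_apply, hX1]
    rw [hx]
    exact h4
  have hint1 : ∫ x, |Z x - X x| ∂νρ ≤ η * (νρ Set.univ).toReal := by
    have hk : ∀ᵐ x ∂νρ, ‖|Z x - X x|‖ ≤ η := by
      filter_upwards [hLρ hZX] with x hx
      rw [Real.norm_eq_abs, abs_abs]
      exact hx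
    calc ∫ x, |Z x - X x| ∂νρ ≤ ‖∫ x, |Z x - X x| ∂νρ‖ := Real.le_norm_self _
      _ ≤ ∫ _, η ∂νρ := norm_integral_le_of_norm_le (integrable_const η) hk
      _ = η * (νρ Set.univ).toReal := by
        rw [integral_const, smul_eq_mul, measureReal_def, mul_comm]
  -- (2) + (1): triangle inequality
  have htri : ∀ x, |Y x - X x| ≤ |Y x - Z x| + |Z x - X x| := fun x => abs_sub_le _ _ _
  calc ∫ x, |Y x - X x| ∂νρ
      ≤ ∫ x, (|Y x - Z x| + |Z x - X x|) ∂νρ :=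
        integral_mono_of_nonneg (Eventually.of_forall fun x => abs_nonneg _)
          ((hYiρ.sub hZiρ).abs.add (hZiρ.sub hXiρ).abs) (Eventually.of_forall htri)
    _ = ∫ x, |Y x - Z x| ∂νρ + ∫ x, |Z x - X x| ∂νρ :=
        integral_add (hYiρ.sub hZiρ).abs (hZiρ.sub hXiρ).abs
    _ ≤ 2 * C * θ * (νρ Set.univ).toReal + η * (νρ Set.univ).toReal := add_le_add h2 hint1
    _ = (η + 2 * C * θ) * (νρ Set.univ).toReal := by ring

end Summit.AtomisticToContinuum.HydrodynamicLimit.Theorems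

end
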